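import Summits.KontsevichZagierPeriods.KontsevichZagierPeriods.Theorems.SoloBlindCauchyStokesA
import Summits.KontsevichZagierPeriods.KontsevichZagierPeriods.Theorems.SoloBlindBeta
import Mathlib.NumberTheory.Niven
import HarnessLib

/-!
# `B(1/5,1/5) = 2cos(π/5)·B(1/5,3/5)` and `B(2/5,2/5) = 2cos(2π/5)·B(2/5,1/5)` inside the rules

Sorry-free.  The bookkeeping that turns the **edge relation** of the Cauchy argument
(file `SoloBlindCauchyStokesA`),

  `[(-∞,0) ∪ (0,½), -P_p(x,0)] ≡ 0`   (`p ∈ {1,2}`, `e = p/5 - 1`, `a = p/5`),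

into identities between Beta classes in the formal period ring `Q`:

1. domain additivity splits the edge representation into `E⁻ = [(-∞,0), -P_p(x,0)]` and
   `E⁺ = [(0,½), -P_p(x,0)]`, so `[E⁻] = -[E⁺]`;
2. on `(0,½)`, `-P_p(x,0) = -x^{a-1}(1-x)^{a-1}`, and splitting `β(a,a)` at `½` plus the
   reflection `t ↦ 1-t` give `[E⁺] = -½ β(a,a)`;
3. on `(-∞,0)`, `-P_p(x,0) = cos(πa)·(-(x(1-x)))^{a-1}`, and the substitution `x = -v/(1-v)`
   (`jacobi_negMoeb`) turns `[(-∞,0), (-(x(1-x)))^{a-1}]` into `β(a, 1-2a)`, so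
   `[E⁻] = cos(πa) • β(a, 1-2a)` (`cos(πa) ∈ ℚ̄`, scaling is the scalar action).

Hence **`β(a,a) = 2cos(πa) • β(a,1-2a)`** in `Q` for `a = 1/5, 2/5`: the first relations of the
programme whose derivation is genuinely two-dimensional (the closed `1`-form `(z(1-z))^{e} dz`)
and whose two sides are Beta values with `Γ(k/5)`-content — `B(1/5,1/5) = Γ(1/5)²/Γ(2/5)` versus
`B(1/5,3/5) = Γ(1/5)Γ(3/5)/Γ(4/5)`; numerically both sides agree (ratio `2cos(π/5) = 1.618…`, the
golden ratio).  No one-variable chain of the moves used so far relates them: their quotient is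
the unit `Γ(1/5)Γ(4/5)/(Γ(2/5)Γ(3/5)) = sin(2π/5)/sin(π/5) = 2cos(π/5)`, i.e. the relation is the
**Gauss multiplication formula content at level 5** reached without cancelling `π`.
-/

noncomputable section

open Set Complex MeasureTheory
open scoped ContDiff
open Literature.ModelTheory.ExponentialFields MvPolynomial
open Literature.NumberTheory.Transcendental
open Literature.NumberTheory.Transcendental.KZ
open Literature.Analysis.SpecialFunctions.Selberg

namespace Summit.KontsevichZagierPeriods.KontsevichZagierPeriods.Theorems

namespace SoloBlind

/-! ## Step 1: splitting the edge representation at `x = 0` -/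

/-- `E⁺ = [(0,½), -P_p(x,0)]`. -/
def edgePos (p : ℕ) (hp : p = 1 ∨ p = 2) : IntegralRep 1 :=
  (edgeRepA p hp).restrict (line (Ioo 0 (1 / 2)))
    (isSemialgebraic_line_Ioo isAlgebraic_zero (by simpa using isAlgebraic_rat ℚ (A := ℝ) (1 / 2)))
    fun _ hx => ⟨hx.2, hx.1.ne'⟩

/-- `E⁻ = [(-∞,0), -P_p(x,0)]`. -/
def edgeNeg (p : ℕ) (hp : p = 1 ∨ p = 2) : IntegralRep 1 :=
  (edgeRepA p hp).restrict (line (Iio 0)) (isSemialgebraic_line_Iio isAlgebraic_zero)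
    fun _ hx => ⟨lt_trans (mem_Iio.mp hx) (by norm_num), (mem_Iio.mp hx).ne⟩

/-- **Rule (1a)**: `[E] - [E⁻] - [E⁺]` is a relation. -/
theorem edge_split (p : ℕ) (hp : p = 1 ∨ p = 2) :
    of (edgeRepA p hp) - of (edgeNeg p hp) - of (edgePos p hp) ∈ relations := by
  refine domainAddRel_subset_relations ⟨1, edgeRepA p hp, edgeNeg p hp, edgePos p hp, ?_, ?_,
    fun _ _ => rfl, fun _ _ => rfl, rfl⟩
  · simp only [edgeRepA, lineRep_domain, edgeNeg, edgePos, IntegralRep.domain_restrict,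
      ← line_union, baseA_eq]
  · simp only [edgeNeg, edgePos, IntegralRep.domain_restrict, ← line_inter, volume_line]
    have he : Iio (0 : ℝ) ∩ Ioo 0 (1 / 2) = ∅ := by
      ext x
      simp only [mem_inter_iff, mem_Iio, mem_Ioo, mem_empty_iff_false, iff_false, not_and]
      intro h1 h2
      linarith
    rw [he, measure_empty]

/-- `[E⁻] + [E⁺] ≡ 0`. -/
theorem edgeNeg_add_edgePos (p : ℕ) (hp : p = 1 ∨ p = 2) :
    of (edgeNeg p hp) + of (edgePos p hp) ∈ relations := by
  have h := relations.sub_mem (of_edgeRepA_mem_relations p hp) (edge_split p hp)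
  convert h using 1
  abel

/-! ## Step 2: the right piece is `-½ β(a,a)` -/

/-- A piece `[S, t^{a-1}(1-t)^{a-1}]` of the diagonal Beta representation, `S ⊆ (0,1)`. -/
abbrev betaPiece (a : ℚ) (ha : 0 < a) (S : Set ℝ) (hS : IsSemialgebraic ℚ (line S))
    (hS1 : S ⊆ Ioo 0 1) : IntegralRep 1 :=
  lineRep S (fun t => t ^ ((a : ℝ) - 1) * (1 - t) ^ ((a : ℝ) - 1)) hS
    (((isSemialgebraicFunOn_const_mul_rpow_mul_rpow 1 (a - 1) (a - 1)).mono
      (fun x hx => hS1 hx) hS).congr fun x _ => by push_cast; ring)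
    ((integrableOn_Ioo_rpow_mul_one_sub_rpow_and_integral_eq (Rat.cast_pos.mpr ha)
      (Rat.cast_pos.mpr ha)).1.mono_set hS1)

/-- `line (0,½)`, `line [½,1)`, `line (½,1)` are semialgebraic and inside `(0,1)`. -/
theorem halfPieces_aux :
    (IsSemialgebraic ℚ (line (Ioo (0 : ℝ) (1 / 2))) ∧ Ioo (0 : ℝ) (1 / 2) ⊆ Ioo 0 1) ∧
    (IsSemialgebraic ℚ (line (Ico (1 / 2 : ℝ) 1)) ∧ Ico (1 / 2 : ℝ) 1 ⊆ Ioo 0 1) ∧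
    (IsSemialgebraic ℚ (line (Ioo (1 / 2 : ℝ) 1)) ∧ Ioo (1 / 2 : ℝ) 1 ⊆ Ioo 0 1) := by
  have h2 : IsAlgebraic ℚ ((1 : ℝ) / 2) := by simpa using isAlgebraic_rat ℚ (A := ℝ) (1 / 2)
  exact ⟨⟨isSemialgebraic_line_Ioo isAlgebraic_zero h2, Ioo_subset_Ioo_right (by norm_num)⟩,
    ⟨isSemialgebraic_line_Ico h2 isAlgebraic_one, fun x hx => ⟨by linarith [hx.1], hx.2⟩⟩,
    ⟨isSemialgebraic_line_Ioo h2 isAlgebraic_one, Ioo_subset_Ioo_left (by norm_num)⟩⟩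

/-- The left half `[(0,½), t^{a-1}(1-t)^{a-1}]` of `β(a,a)`. -/
abbrev halfLo (a : ℚ) (ha : 0 < a) : IntegralRep 1 :=
  betaPiece a ha (Ioo 0 (1 / 2)) halfPieces_aux.1.1 halfPieces_aux.1.2

/-- The closed-left right half `[[½,1), t^{a-1}(1-t)^{a-1}]` of `β(a,a)`. -/
abbrev halfHiC (a : ℚ) (ha : 0 < a) : IntegralRep 1 :=
  betaPiece a ha (Ico (1 / 2) 1) halfPieces_aux.2.1.1 halfPieces_aux.2.1.2

/-- The open right half `[(½,1), t^{a-1}(1-t)^{a-1}]` of `β(a,a)`. -/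
abbrev halfHi (a : ℚ) (ha : 0 < a) : IntegralRep 1 :=
  betaPiece a ha (Ioo (1 / 2) 1) halfPieces_aux.2.2.1 halfPieces_aux.2.2.2

/-- **`β(a,a) ≡ 2·[(0,½), t^{a-1}(1-t)^{a-1}]`**: split at `½` (rule (1a)), drop the point `½`
(null), reflect the right half by `t ↦ 1-t` (rule (2)). -/
theorem betaRep_sub_two_halfLo (a : ℚ) (ha : 0 < a) :
    of (betaRep a a ha ha) - (of (halfLo a ha) + of (halfLo a ha)) ∈ relations := by
  have h1 : of (betaRep a a ha ha) - of (halfLo a ha) - of (halfHiC a ha) ∈ relations := by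
    refine domainAddRel_subset_relations ⟨1, betaRep a a ha ha, halfLo a ha, halfHiC a ha, ?_, ?_,
      fun _ _ => rfl, fun _ _ => rfl, rfl⟩
    · simp only [betaRep, lineRep_domain, ← line_union,
        Ioo_union_Ico_eq_Ioo (show (0 : ℝ) < 1 / 2 by norm_num) (show (1 / 2 : ℝ) ≤ 1 by norm_num)]
    · simp only [lineRep_domain, ← line_inter, volume_line]
      have he : Ioo (0 : ℝ) (1 / 2) ∩ Ico (1 / 2) 1 = ∅ := by
        ext x
        simp only [mem_inter_iff, mem_Ioo, mem_Ico, mem_empty_iff_false, iff_false, not_and]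
        intro _ h2 h3
        linarith
      rw [he, measure_empty]
  have h2 : of (halfHiC a ha) - of (halfHi a ha) ∈ relations :=
    (halfHiC a ha).of_sub_of_restrict_mem_relations halfPieces_aux.2.2.1
      (fun x hx => show x 0 ∈ Ico (1 / 2 : ℝ) 1 from Ioo_subset_Ico_self (mem_line.mp hx)) (by
        show volume (line (Ico (1 / 2 : ℝ) 1 \ Ioo (1 / 2) 1)) = 0
        rw [volume_line, Ico_sdiff_Ioo_same (by norm_num), Real.volume_singleton])
  have h3 : of (halfHi a ha) - of (halfLo a ha) ∈ relations := by
    refine lineRep_subst (fun t => 1 - t) (fun _ => -1)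
      ((isSemialgebraicFunOn_aeval halfPieces_aux.2.2.1 (1 - X 0)).congr fun x _ => by simp)
      (fun t _ => ((hasDerivAt_id t).const_sub 1).hasDerivWithinAt)
      (fun s _ t _ h => sub_right_inj.mp h) ?_ fun t _ => ?_
    · rw [image_const_sub_Ioo]
      norm_num
    · rw [sub_sub_cancel, abs_neg, abs_one, mul_one, mul_comm]
  have h := relations.add_mem (relations.add_mem h1 h2) h3
  convert h using 1
  abel

/-- `[E⁺] + [(0,½), t^{a-1}(1-t)^{a-1}] ≡ 0` for `a = p/5`. -/
theorem edgePos_add_halfLo (p : ℕ) (hp : p = 1 ∨ p = 2) (ha : 0 < (p : ℚ) / 5) :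
    of (edgePos p hp) + of (halfLo ((p : ℚ) / 5) ha) ∈ relations := by
  refine of_add_of_mem_relations_of_neg rfl fun x hx => ?_
  have hx' : 0 < x 0 ∧ x 0 < 1 / 2 := hx
  have hcast : ((((p : ℚ) / 5 : ℚ) : ℝ) - 1) = (p : ℝ) / 5 - 1 := by push_cast; ring
  simp only [lineRep_integrand, edgePos, IntegralRep.integrand_restrict, edgeRepA]
  rw [hcast, edgeF_eq_of_pos p hx'.1 (by linarith), neg_neg]

/-! ## Step 3: the left piece is `cos(πa) • β(a, 1-2a)` -/

/-- `N = [(-∞,0), (-(x(1-x)))^{e}]`, `e = p/5 - 1`. -/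
def negRep (p : ℕ) (hp : p = 1 ∨ p = 2) : IntegralRep 1 :=
  lineRep (Iio 0) (fun x => (-(x * (1 - x))) ^ ((p : ℝ) / 5 - 1))
    (isSemialgebraic_line_Iio isAlgebraic_zero)
    ((isSemialgebraicFunOn_mellinIntegrand (isSemialgebraic_line_Iio isAlgebraic_zero)
      ![-X 0, 1 - X 0] ![(p : ℚ) / 5 - 1, (p : ℚ) / 5 - 1] 1 (fun x hx k => by
        have hx' : x 0 < 0 := hx
        fin_cases k
        · simpa using hx'
        · simp only [Fin.mk_one, Matrix.cons_val_one, Matrix.cons_val_fin_one, map_sub, map_one,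
            MvPolynomial.aeval_X, sub_pos]
          linarith)).congr fun x hx => by
        have hx' : x 0 < 0 := hx
        rw [mellinIntegrand_apply, Fin.prod_univ_two]
        simp only [Matrix.cons_val_zero, Matrix.cons_val_one, Matrix.cons_val_fin_one, map_neg,
          map_sub, map_one, MvPolynomial.aeval_X, Rat.cast_one, one_mul]
        rw [← Real.mul_rpow (by linarith) (by linarith)]
        push_cast
        ring_nf)
    (integrableOn_negSide (by rcases hp with rfl | rfl <;> norm_num)
      (by rcases hp with rfl | rfl <;> norm_num))

/-- `cos(π(a-1)) = -cos(πa)`. -/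
theorem cos_pi_mul_sub_one (a : ℝ) : Real.cos (Real.pi * (a - 1)) = -Real.cos (Real.pi * a) := by
  rw [mul_sub, mul_one, Real.cos_sub_pi]

/-- `cos(π p/5)` is real algebraic. -/
theorem isAlgebraic_cosFifth (p : ℕ) : IsAlgebraic ℚ (Real.cos (Real.pi * ((p : ℝ) / 5))) := by
  have h := (Real.isAlgebraic_cos_rat_mul_pi ((p : ℚ) / 5)).extendScalars
    (R := ℤ) (S := ℚ) (A := ℝ) (RingHom.injective_int (algebraMap ℤ ℚ))
  rw [show (((p : ℚ) / 5 : ℚ) : ℝ) * Real.pi = Real.pi * ((p : ℝ) / 5) by push_cast; ring] at h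
  exact h

/-- `[E⁻] ≡ cos(πa) · N`. -/
theorem edgeNeg_sub_constMul_negRep (p : ℕ) (hp : p = 1 ∨ p = 2) :
    of (edgeNeg p hp) - of ((negRep p hp).constMul (Real.cos (Real.pi * ((p : ℝ) / 5)))
      (isAlgebraic_cosFifth p)) ∈ relations := by
  refine of_sub_of_mem_relations_of_eqOn rfl fun x hx => ?_
  have hx' : x 0 < 0 := hx
  simp only [edgeNeg, IntegralRep.integrand_restrict, edgeRepA, lineRep_integrand,
    IntegralRep.integrand_constMul, negRep]
  rw [edgeF_eq_of_neg p hx', cos_pi_mul_sub_one]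
  ring

/-- **Rule (2) along `x = -v/(1-v)`**: `β(a, 1-2a) ≡ N`. -/
theorem betaRep_sub_negRep (p : ℕ) (hp : p = 1 ∨ p = 2) (ha : 0 < (p : ℚ) / 5)
    (hb : 0 < 1 - 2 * ((p : ℚ) / 5)) :
    of (betaRep ((p : ℚ) / 5) (1 - 2 * ((p : ℚ) / 5)) ha hb) - of (negRep p hp) ∈ relations := by
  have h1 : ((((p : ℚ) / 5 : ℚ) : ℝ) - 1) = (p : ℝ) / 5 - 1 := by push_cast; ring
  have h2 : (((1 - 2 * ((p : ℚ) / 5) : ℚ) : ℝ) - 1) = -2 * ((p : ℝ) / 5 - 1) - 2 := by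
    push_cast; ring
  refine lineRep_subst (fun v => -moeb v) (fun v => -(1 / (1 - v) ^ 2)) ?_
    (fun v hv => (hasDerivAt_moeb (ne_of_lt hv.2)).neg.hasDerivWithinAt) injOn_negMoeb
    image_negMoeb.symm fun v hv => ?_
  · refine (isSemialgebraicFunOn_aeval_div_aeval
      (isSemialgebraic_line_Ioo isAlgebraic_zero isAlgebraic_one) (-X 0) (1 - X 0)
      fun x hx => ?_).congr fun x _ => ?_
    · have hx' : 0 < x 0 ∧ x 0 < 1 := hx
      simpa [sub_eq_zero] using (ne_of_lt hx'.2).symm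
    · simp [moeb, neg_div]
  · have h1v : 0 < 1 - v := by linarith [hv.2]
    rw [h1, h2, abs_neg, abs_of_pos (by positivity : (0 : ℝ) < 1 / (1 - v) ^ 2),
      jacobi_negMoeb _ hv]

/-! ## The headline relations -/

/-- The real algebraic number `2cos(πp/5)` as a scalar in `K₀`. -/
def twoCosFifth (p : ℕ) : K₀ :=
  ⟨2 * Real.cos (Real.pi * ((p : ℝ) / 5)),
    mul_mem (by simp) (mem_K₀_iff.mpr (isAlgebraic_cosFifth p))⟩

/-- `(twoCosFifth p : ℝ) = 2cos(πp/5)`. -/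
theorem twoCosFifth_val (p : ℕ) :
    (twoCosFifth p : ℝ) = 2 * Real.cos (Real.pi * ((p : ℝ) / 5)) := rfl

/-- **`β(a,a) = 2cos(πa) • β(a, 1-2a)` in `Q`** for `a = p/5`, `p ∈ {1, 2}` — Green's formula for
`(z(1-z))^{a-1} dz` on `{x < ½, y > 0}`, run inside the Kontsevich–Zagier rules. -/
theorem betaQ_diag_fifth (p : ℕ) (hp : p = 1 ∨ p = 2) :
    betaQ ((p : ℚ) / 5) ((p : ℚ) / 5) =
      twoCosFifth p • betaQ ((p : ℚ) / 5) (1 - 2 * ((p : ℚ) / 5)) := by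
  have ha : 0 < (p : ℚ) / 5 := by rcases hp with rfl | rfl <;> norm_num
  have hb : 0 < 1 - 2 * ((p : ℚ) / 5) := by rcases hp with rfl | rfl <;> norm_num
  set c : K₀ := ⟨Real.cos (Real.pi * ((p : ℝ) / 5)), mem_K₀_iff.mpr (isAlgebraic_cosFifth p)⟩
    with hc
  have h1 : mkQ (of (edgeNeg p hp)) = -mkQ (of (edgePos p hp)) :=
    eq_neg_of_add_eq_zero_left (by
      rw [← map_add, mkQ_eq_zero_iff]
      exact edgeNeg_add_edgePos p hp)
  have h2 : mkQ (of (halfLo ((p : ℚ) / 5) ha)) = -mkQ (of (edgePos p hp)) :=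
    eq_neg_of_add_eq_zero_right (by
      rw [← map_add, mkQ_eq_zero_iff]
      exact edgePos_add_halfLo p hp ha)
  have h3 : betaQ ((p : ℚ) / 5) ((p : ℚ) / 5) =
      mkQ (of (halfLo ((p : ℚ) / 5) ha)) + mkQ (of (halfLo ((p : ℚ) / 5) ha)) := by
    rw [betaQ_eq ha ha, ← map_add, mkQ_eq_mkQ_iff]
    exact betaRep_sub_two_halfLo _ ha
  have h4 : mkQ (of (edgeNeg p hp)) = c • betaQ ((p : ℚ) / 5) (1 - 2 * ((p : ℚ) / 5)) := by
    rw [mkQ_eq_mkQ_iff.mpr (edgeNeg_sub_constMul_negRep p hp), mkQ_constMul, betaQ_eq ha hb,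
      mkQ_eq_mkQ_iff.mpr (betaRep_sub_negRep p hp ha hb)]
  rw [h3, h2, ← h1, h4, ← add_smul]
  congr 1
  exact Subtype.ext (show (c : ℝ) + c = 2 * Real.cos (Real.pi * ((p : ℝ) / 5)) from
    (two_mul _).symm)

/-- **`B(1/5,1/5) = φ · B(1/5,3/5)` inside the rules**, `φ = 2cos(π/5) = (1+√5)/2` the golden
ratio: `[β(1/5,1/5)] = φ • [β(1/5,3/5)]` in `Q`. -/
theorem betaQ_fifth_fifth :
    betaQ (1 / 5) (1 / 5) = twoCosFifth 1 • betaQ (1 / 5) (3 / 5) ∧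
      (twoCosFifth 1 : ℝ) = Real.goldenRatio := by
  refine ⟨?_, ?_⟩
  · have h := betaQ_diag_fifth 1 (Or.inl rfl)
    norm_num at h
    exact h
  · rw [twoCosFifth_val, Real.goldenRatio, Nat.cast_one, ← mul_div_assoc, mul_one,
      Real.cos_pi_div_five]
    ring

/-- **`B(2/5,2/5) = 2cos(2π/5) · B(2/5,1/5)` inside the rules**: `[β(2/5,2/5)] =
2cos(2π/5) • [β(2/5,1/5)]` in `Q`, and `2cos(2π/5) = (√5-1)/2 = φ⁻¹`. -/
theorem betaQ_twoFifth_twoFifth :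
    betaQ (2 / 5) (2 / 5) = twoCosFifth 2 • betaQ (2 / 5) (1 / 5) ∧
      (twoCosFifth 2 : ℝ) = (Real.sqrt 5 - 1) / 2 := by
  refine ⟨?_, ?_⟩
  · have h := betaQ_diag_fifth 2 (Or.inr rfl)
    norm_num at h
    exact h
  · have h2 : Real.pi * ((2 : ℕ) / 5 : ℝ) = 2 * (Real.pi / 5) := by push_cast; ring
    rw [twoCosFifth_val, h2, Real.cos_two_mul, Real.cos_pi_div_five]
    have h5 : Real.sqrt 5 ^ 2 = 5 := Real.sq_sqrt (by norm_num)
    nlinarith [h5]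

end SoloBlind

end Summit.KontsevichZagierPeriods.KontsevichZagierPeriods.Theorems
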